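/-
Copyright (c) 2026 the pub-hodgecm-mathlib formalisation cell (harness21).  Prover seat hodgecm-mathlib-LH4-p11 (g9), req620 Track A «(D-RAM) FOUR-FRAME» squad, helper lane on
h413 = stmt-HodgeConjecture-24833 (count-neutral).  β-BOARD v1 (sub-dealer LH4-p05 (g8)) ROW R2 «G₃ PURE», sub-row (P2a) THE PER-LATTICE READ (dealer WORD #123, LEDGER #3);
recipe `F0/P3c/LH4/LH4-p11/g8/stageB/VERDICT-G3row.v1.LH4p11g8.md` §1–§2 over LH7-p06 (g0)'s ★ p861251 infrastructure.  2026-09-04.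
-/
import Summits.HodgeConjecture.HodgeConjecture.Theorems.F0P3cDyRamLabelledOddOneSlotKappa        -- ★ p860757 (F0P3-p01 (g36)): abstract one-slot heads `…_eq_kappaCount_mul_of_oneSlot` ∕ `…_of_oneSlot_same`
import Summits.HodgeConjecture.HodgeConjecture.Theorems.F0P3cDyRamTwoSlotLabelRead              -- ★ (LH4-p13 (g8), (L-lab-20a)): `valueClassLabel_latt_hnf_iff_normSign` (the top-A read on any HNF `(1 0 0; x ϖ^b 0; y z ϖ^c)`)
import Summits.HodgeConjecture.HodgeConjecture.Theorems.F0P3cDyRamDiagonalGluedStratumG3        -- ★ p861251 (LH7-p06 (g0)): `v_polarisation_latt_G3`, `v_gram_cancel_latt_G3_le`, `v_sub_le_of_mem_fixedUnitStabilizer_latt_G3`, `det_latt_G3_ne_zero`, `isNormalisedLattice_latt_G3`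
import Summits.HodgeConjecture.HodgeConjecture.Theorems.F0P3cDyRamDiagonalOrbitFibreTransport     -- ★ (LH4-p11 (g2)): `fibre_isCoset_zero`
import Summits.HodgeConjecture.HodgeConjecture.Theorems.F0P3cDyRamFixedCountDiagonalModel        -- ★ (LH4-p11 (g0)): `normSign_mul_norm`
import Summits.HodgeConjecture.HodgeConjecture.Theorems.F0P3cDyRamLabelledOddStageAOfRecord       -- ★ p860462 (LH4-p11 (g8)): brings ★ `finite_unitTorus_orbit_of_mem_normalisedStableLattices`
import Summits.HodgeConjecture.HodgeConjecture.Theorems.F0P3cDyRamStableCountTypeZero              -- ★ (LH4-p12): `v_diag_eq_one`, `diag_regular`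
import Summits.HodgeConjecture.HodgeConjecture.Theorems.F0P3cDyRamStageOneBDefs                   -- ★ DEFS №5: `mcOfRecord`; brings `mstarOfRecord`
import Literature.NumberTheory.LocalFields.WildQuadraticDatumNonNormUnit                          -- ★ `exists_nonnorm_dichotomy_of_isRamifiedQuadraticDatum`
import Literature.NumberTheory.LocalFields.ValuedCompleteIsAdicComplete                           -- ★ `isAdicComplete_valuedInteger_of_completeSpace`
import HarnessLib

/-!
# Crux `H413`, line LH4 «(D-RAM) FOUR-FRAME» — (β-BAL) Stage B, β-BOARD ROW R2 «G₃ PURE», (P2a): the per-lattice read on the glued stratum `G₃ = (2ρ+s, 2ρ+s, 2ρ)`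
# `labelledOddCount σ ϖ 0 i Λ M ∕ [𝒰 : N(S̃′(M))] = ω(−1)·ω(e_C) ∕ 2 · (1, κ₂(M), κ₁(M))_i · stabiliserWeight σ M` in the one-slot cell `2ρ + m* ≤ n₁`

Cell `hodgecm-mathlib` (D-0151), FLOOR 0, crux item H413 = `stmt-HodgeConjecture-24833`, route `HCCMUnconditional`; squad F0∕P3c∕LH4.  THEOREMS ONLY (no `def`, no instance, no
notation, no `sorry`, default heartbeats); ★-only imports; lane `--supports stmt-HodgeConjecture-24833 --as helper` (count-neutral); pays NO row, states NO law.
THE MATHEMATICS (LH4-p11 (g8) VERDICT-G3row v1 §1; LH4-p05 (g8)'s box currency; the T₃ = G₃(ρ = 0) template is ★ `F0P3cDyRamLabelledOddPureStrataT3` §1).  A member of the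
stratum is the G₃ normal form `M = latt (1 0 0; x ϖ^{ρ+s} 0; y z ϖ^{2ρ})`, `|x| = |y| = 1`, `|z| = |ϖ|^ρ` (★ `stratum_G3_eq`), with an abstract `σ`-fixed type-`0` polarisation `D`
(`IsDualisableLattice`) of valuations `|D₀| = |D₁| = exp(2ρ+s)`, `|D₂| = exp 2ρ` (★ `v_polarisation_latt_G3`).  The type-`0` fibre of `M` is the coset `D·S_F(M)` (★ `fibre_isCoset_zero`),
and for `u ∈ S_F(M)` the top value of the label form at `D·u` is
`A(u) = D₀u₀(α−1) + D₁u₁N(x)(β−1) = −D₀u₀(β−α) + u₀(D₀ + D₁N(x))(β−1) + (u₁−u₀)D₁N(x)(β−1)`.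
THE GRAM CANCELLATION ★ `v_gram_cancel_latt_G3_le` (`|D₀ + σx·D₁·x| ≤ exp 2ρ`, from the integrality of the `(0,0)` Gram entry) and the stabiliser tube ★
`v_sub_le_of_mem_fixedUnitStabilizer_latt_G3` (`|u₁−u₀| ≤ |ϖ|^{ρ+s}`) make the last two terms `ϖ^{m*}`-small exactly in the CELL `2ρ + m* ≤ n₁`, while the main term has valuation
`exp(2ρ+s−n₃) = |ϖ|^{ℓ₀}` on the READ `2ρ + s + ℓ₀ = n₃` and, with the TOWER-SIGN TOKEN `e_C` of `β − α` at exponent `j = ρ + s∕2` (`|(ϖ^{m*})⁻¹((β−α)·π₀^{−j} − e_C·t₊)| ≤ 1`,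
`|D₀π₀^j| = 1`), is `ϖ^{m*}`-congruent to `G·t₊` with the σ-fixed unit `G = u₀·(−D₀·e_C)·π₀^j`.  LH4-p13's ★ top-A read `valueClassLabel_latt_hnf_iff_normSign` (at `(b, c) = (ρ+s, 2ρ)`)
therefore gives the ONE-SLOT SHAPE in slot `0`: `Λ M (D·u) ↔ ε·ω(u₀) = 1`, `ε = ω(−D₀e_C)` (`π₀^j = N(ϖ^j)` is a norm), and F0P3-p01's ★ p860757 abstract heads read the three slots as
`ε·ω(D₀)∕2·(1, κ₂(M), κ₁(M))_i·stabiliserWeight σ M = ω(−1)ω(e_C)∕2·(1, κ₂, κ₁)_i·w` — the κ of ★ `kappaCount` are left SYMBOLIC, to be summed by the ★ G₃ κ∕weight sockets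
(★ `finsum_kappaCount_mul_stabiliserWeight_hasAxis_G3`: `Σ κ₂w = ω(−1)q^e·b(s)`, `Σ κ₁w = Σ κ₀w = 0`; ★ `finsum_stabiliserWeight_stratum_G3_of_G1`) in the (P2b) sum file.
HONEST LABEL: count-neutral; R2's sum file, SIG-B2b3, (β-BAL), (β), T₊ OPEN; `HC_CM` is proved only modulo the 7 printed citations (2 remaining named inputs: hLiu418 =
`stmt-HodgeConjecture-24832`, h413 = `stmt-HodgeConjecture-24833`) until rung 0 closes.
References: [Kottwitz1986BaseChangeUnits] §1 pp. 240–241 · [Rogawski1990] §4.9 Prop. 4.9.1 (a)(b) p. 55, §4.10 p. 58 · [LanglandsShelstad1987] §3 · [Serre1979] Ch. V §3 Cor. 3 ·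
[Jacobowitz1962] §4, §7.
-/

set_option autoImplicit false

noncomputable section

namespace Summit.HodgeConjecture.HodgeConjecture.Cruxes.H413.F0P3cDyRamLabelledOddPureLatticeG3

open Literature.NumberTheory.Automorphic Literature.NumberTheory.Automorphic.HermitianLattice
open Literature.NumberTheory.Automorphic.UnitaryLatticeTree Literature.NumberTheory.Automorphic.UnitaryThreeFourFrame
open Literature.NumberTheory.LocalFields Literature.NumberTheory.LocalFields.WildQuadraticDatum
open Summit.HodgeConjecture.HodgeConjecture.Cruxes.H413.F0P3cDyRamFourFramePieces
open Summit.HodgeConjecture.HodgeConjecture.Cruxes.H413.F0P3cDyRamFourFrameCensusDefs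
open Summit.HodgeConjecture.HodgeConjecture.Cruxes.H413.F0P3cDyRamStageOneBDefs (mcOfRecord)
open Summit.HodgeConjecture.HodgeConjecture.Cruxes.H413.F0P3cDyRamDiagonalTorusDefs
open Summit.HodgeConjecture.HodgeConjecture.Cruxes.H413.F0P3cDyRamDiagonalStrataDefs
open Summit.HodgeConjecture.HodgeConjecture.Cruxes.H413.F0P3cDyRamDiagonalKappaCountDefs
open Summit.HodgeConjecture.HodgeConjecture.Cruxes.H413.F0P3cDyRamLabelledOddCountDefs
open Summit.HodgeConjecture.HodgeConjecture.Cruxes.H413.F0P3cDyRamStableSumSignClasses (normSign_eq_one_or)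
open Summit.HodgeConjecture.HodgeConjecture.Cruxes.H413.F0P3cDyRamFixedCountDiagonalModel (normSign_mul_norm)
open Summit.HodgeConjecture.HodgeConjecture.Cruxes.H413.F0P3cDyRamDiagonalOrbitFibreTransport (fibre_isCoset_zero)
open Summit.HodgeConjecture.HodgeConjecture.Cruxes.H413.F0P3cDyRamDiagonalKappaSplitCountEval (normSign_mul_self)
open Summit.HodgeConjecture.HodgeConjecture.Cruxes.H413.F0P3cDyRamDiagonalGluedStratumG3
open Summit.HodgeConjecture.HodgeConjecture.Cruxes.H413.F0P3cDyRamStableCountTypeZero (v_diag_eq_one diag_regular)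
open Summit.HodgeConjecture.HodgeConjecture.Cruxes.H413.F0P3cDyRamDiagonalOrbitFibreCountHeads (finite_unitTorus_orbit_of_mem_normalisedStableLattices)
open Summit.HodgeConjecture.HodgeConjecture.Cruxes.H413.F0P3cDyRamTwoSlotLabelRead (valueClassLabel_latt_hnf_iff_normSign)
open Summit.HodgeConjecture.HodgeConjecture.Cruxes.H413.F0P3cDyRamLabelledOddOneSlotKappa
open scoped Valued WithZero Matrix MatrixGroups

variable {K : Type} [Field K] [Valued K ℤᵐ⁰] [CompleteSpace K] [Fintype 𝓀[K]] {σ : K →+* K} {ϖ : K} {d t : ℕ} {α β : K} {N₀ n₁ n₂ n₃ : ℕ}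

/-! ## §1  Per lattice: the value on the G₃ normal form at the element letters, in the one-slot cell `2ρ + m* ≤ n₁` -/

/-- **PER-LATTICE VALUE ON THE G₃ NORMAL FORM** `M₀ = latt (1 0 0; x ϖ^{ρ+s} 0; y z ϖ^{2ρ})` (`|x| = |y| = 1`, `|z| = |ϖ|^ρ`, `ρ, s ≥ 1`, `2ρ + s = 2j`; element datum at
`N₀ ≥ mcOfRecord d`, `2 ≤ d`; `M₀` is `T`-stable, dualisable and on the clean shell; CELL `2ρ + m* ≤ n₁`, READ `2j + ℓ₀ = n₃`; `e_C` a σ-fixed unit with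
`|(ϖ^{m*})⁻¹((β−α)·π₀^{−j} − e_C·t₊)| ≤ 1`):
`labelledOddCount σ ϖ 0 i Λ M₀ ∕ [𝒰 : N(S̃′)] = ω(−1)·ω(e_C) ∕ 2 · (1, κ₂(M₀), κ₁(M₀))_i · stabiliserWeight σ M₀` for `Λ = valueClassLabel σ ϖ (α−1) (β−1) m* d`
(★ Gram cancellation + ★ stabiliser tube ⇒ one-slot shape in slot `0` by ★ p13's top-A read; ★ p860757 heads; κ symbolic). [cite: Kottwitz1986BaseChangeUnits, §1 pp. 240–241]
[cite: Rogawski1990, §4.9 Prop. 4.9.1 (a)(b) p. 55, §4.10 p. 58] [cite: LanglandsShelstad1987, §3] [cite: Serre1979, Ch. V §3 Cor. 3] [cite: Jacobowitz1962, §4, §7] -/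
theorem labelledOddCount_div_relIndex_latt_G3 (hD : IsRamifiedQuadraticDatum σ ϖ d t) (h2d : 2 ≤ d)
    (hE : IsElementDatum σ ϖ N₀ α β n₁ n₂ n₃) (hmc : mcOfRecord d ≤ N₀)
    (T : GL (Fin 3) K) (hT : (T : Matrix (Fin 3) (Fin 3) K) = Matrix.diagonal ![α, β, 1])
    {ρ s : ℕ} (hρ : 1 ≤ ρ) (hs : 1 ≤ s) {x y z : K} (hx : Valued.v x = 1) (hy : Valued.v y = 1) (hz : Valued.v z = Valued.v (ϖ ^ ρ))
    (j : ℕ) (hjs : 2 * ρ + s = 2 * j) (hjn : 2 * j + d % 2 = n₃) (hcell : 2 * ρ + (d % 2 + 2 * d - 1) ≤ n₁)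
    {M₀ : Submodule 𝒪[K] (Fin 3 → K)} (hM₀ : M₀ = latt (!![1, 0, 0; x, ϖ ^ (ρ + s), 0; y, z, ϖ ^ (2 * ρ)] : Matrix (Fin 3) (Fin 3) K))
    (hTM : mapGL T M₀ = M₀) (hdual : IsDualisableLattice σ ϖ M₀)
    (hlev : LatticeInLevel ϖ (d % 2) (Matrix.diagonal ![α - 1, β - 1, 0]) M₀) (hnlev : ¬ LatticeInLevel ϖ (d % 2 + 1) (Matrix.diagonal ![α - 1, β - 1, 0]) M₀)
    (hsq : LatticeInLevel ϖ (mcOfRecord d) (Matrix.diagonal ![(α - 1) * (α - 1), (β - 1) * (β - 1), 0]) M₀)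
    (hfin : {M : Submodule 𝒪[K] (Fin 3 → K) | ∃ u ∈ unitTorus K 3, M = mapGL (diagGLUnits u) M₀}.Finite)
    {eC : K} (hσeC : σ eC = eC) (heC1 : Valued.v eC = 1)
    (heC : Valued.v ((ϖ ^ (d % 2 + 2 * d - 1))⁻¹ * ((β - α) * ((ϖ * σ ϖ) ^ j)⁻¹ - eC * ((ϖ - σ ϖ) * ((ϖ * σ ϖ) ^ ((d - d % 2) / 2))⁻¹))) ≤ 1) (i : Fin 3) :
    (labelledOddCount σ ϖ 0 i (valueClassLabel σ ϖ (α - 1) (β - 1) (d % 2 + 2 * d - 1) d) M₀ : ℚ) /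
        ((((unitStabilizer M₀).map (unitNormMap σ 3)).relIndex (fixedUnitTorus σ 3) : ℕ) : ℚ) =
      (normSign σ (-1 : K) : ℚ) * (normSign σ eC : ℚ) / 2 *
        ((((![1, kappaCount σ ϖ 0 2 M₀, kappaCount σ ϖ 0 1 M₀] : Fin 3 → ℤ) i) : ℤ) : ℚ) * stabiliserWeight σ M₀ := by
  have hD' := hD
  obtain ⟨hσ, hvσ, hϖ, -, -, -, -⟩ := hD'
  haveI : IsAdicComplete 𝓂[K] 𝒪[K] := isAdicComplete_valuedInteger_of_completeSpace hϖ
  haveI : Finite 𝓀[K] := Finite.of_fintype _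
  obtain ⟨c, hσc, hcv, hc, hdich⟩ := exists_nonnorm_dichotomy_of_isRamifiedQuadraticDatum σ ϖ d t hD
  have hϖ0 : ϖ ≠ 0 := fun h0 => by rw [h0, map_zero] at hϖ; exact WithZero.coe_ne_zero hϖ.symm
  have hϖ1 : Valued.v ϖ ≤ 1 := by rw [hϖ, ← WithZero.exp_zero, WithZero.exp_le_exp]; norm_num
  have hσϖ0 : σ ϖ ≠ 0 := (map_ne_zero σ).2 hϖ0
  have heC0 : eC ≠ 0 := fun h => by rw [h, map_zero] at heC1; exact zero_ne_one heC1
  have hπ₀σ : σ (ϖ * σ ϖ) = ϖ * σ ϖ := by rw [map_mul, hσ, mul_comm]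
  have hπjσ : σ ((ϖ * σ ϖ) ^ j) = (ϖ * σ ϖ) ^ j := by rw [map_pow, hπ₀σ]
  have hπ0 : ((ϖ * σ ϖ) ^ j : K) ≠ 0 := pow_ne_zero _ (mul_ne_zero hϖ0 hσϖ0)
  have hα : Valued.v (α - 1) = Valued.v ϖ ^ n₂ := hE.2.2.2.2.2.2.1
  have hβ : Valued.v (β - 1) = Valued.v ϖ ^ n₁ := hE.2.2.2.2.2.1
  have hγ : Valued.v (α - β) = Valued.v ϖ ^ n₃ := hE.2.2.2.2.2.2.2.1
  have hn₁ : N₀ ≤ n₁ := hE.2.2.2.2.2.2.2.2.1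
  have hn₂ : N₀ ≤ n₂ := hE.2.2.2.2.2.2.2.2.2.1
  have hn₃ : N₀ ≤ n₃ := hE.2.2.2.2.2.2.2.2.2.2
  have hmcv : mcOfRecord d = 2 * ((d % 2 + 2 * d - 1 + d) / 2) := rfl
  have hq : ∀ n : ℕ, Valued.v (ϖ ^ n) = WithZero.exp (-(n : ℤ)) := fun n => by rw [map_pow, v_varpi_pow hϖ]
  -- the abstract polarisation of the dualisable member, its valuations, the Gram cancellation, the fibre and the tube
  obtain ⟨D₁, hD₁, hV₁⟩ := hdual
  have hV₁' := hV₁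
  rw [hM₀] at hV₁'
  obtain ⟨hvD0, hvD1, -⟩ := v_polarisation_latt_G3 hvσ hϖ (fun k => (hD₁ k).2) hρ hs hx hy hz hV₁'
  have hgram := v_gram_cancel_latt_G3_le hvσ hϖ (fun k => (hD₁ k).2) hρ hs hx hy hz hV₁'
  have hzle : Valued.v z ≤ 1 := by rw [hz, hq, ← WithZero.exp_zero, WithZero.exp_le_exp]; omega
  have hnorm := isNormalisedLattice_latt_G3 hϖ1 hx hy hzle ρ s
  rw [← hM₀] at hnorm
  have hcoset := fibre_isCoset_zero hvσ ϖ (Matrix.GeneralLinearGroup.mkOfDetNeZero _ (det_latt_G3_ne_zero hϖ0 x y z ρ s)) hM₀ hnorm _ hD₁ hV₁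
  have hSF : ∀ u ∈ fixedUnitStabilizer σ M₀, Valued.v (((u 1 : Kˣ) : K) - (u 0 : Kˣ)) ≤ Valued.v (ϖ ^ (ρ + s)) := fun u hu => by
    rw [hM₀] at hu
    exact (v_sub_le_of_mem_fixedUnitStabilizer_latt_G3 σ hϖ0 hϖ1 hx hz hu).1
  -- the HNF spelling of p13's read
  have hform : (!![1, 0, 0; x, ϖ ^ (ρ + s), 0; y, z, ϖ ^ (2 * ρ)] : Matrix (Fin 3) (Fin 3) K) =
      Matrix.of ![![1, 0, 0], ![x, ϖ ^ (ρ + s), 0], ![y, z, ϖ ^ (2 * ρ)]] := rfl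
  -- `|D₀·π₀^j| = 1` and the valuation of `N(x) = 1`
  have hD0π : Valued.v (D₁ 0 * (ϖ * σ ϖ) ^ j) = 1 := by
    rw [map_mul, hvD0, map_pow, map_mul, hvσ, ← pow_two, ← pow_mul, v_varpi_pow hϖ, ← WithZero.exp_add, ← WithZero.exp_zero]
    congr 1; push_cast; omega
  have hNx : Valued.v (σ x * x) = 1 := by rw [map_mul, hvσ, hx, one_mul]
  -- THE ONE-SLOT SHAPE of the label on the fibre `D₁·S_F`, with `ε = ω(−D₀·e_C)`
  have hΛ : ∀ u ∈ fixedUnitStabilizer σ M₀,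
      valueClassLabel σ ϖ (α - 1) (β - 1) (d % 2 + 2 * d - 1) d M₀ (fun k => D₁ k * ((u k : Kˣ) : K)) ↔
        normSign σ (-(D₁ 0 * eC)) * normSign σ ((u 0 : Kˣ) : K) = 1 := by
    intro u hu
    have h10 : Valued.v (((u 1 : Kˣ) : K) - (u 0 : Kˣ)) ≤ Valued.v (ϖ ^ (ρ + s)) := hSF u hu
    obtain ⟨huv, huσ⟩ := (mem_fixedUnitTorus_iff σ u).1 (Subgroup.mem_inf.1 (show u ∈ fixedUnitStabilizer σ M₀ from hu)).2
    have hDuσ : ∀ k, σ (D₁ k * ((u k : Kˣ) : K)) = D₁ k * ((u k : Kˣ) : K) := fun k => by rw [map_mul, (hD₁ k).1, huσ k]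
    have hDu0 : ∀ k, D₁ k * ((u k : Kˣ) : K) ≠ 0 := fun k => mul_ne_zero (hD₁ k).2 (u k).ne_zero
    have hVu : IsVertexLattice σ ϖ (Matrix.diagonal fun k => D₁ k * ((u k : Kˣ) : K)) 0 M₀ := (hcoset _ fun k => ⟨hDuσ k, hDu0 k⟩).2 ⟨u, hu, fun k => rfl⟩
    -- the top value `A(u) = −D₀u₀(β−α) + u₀(D₀ + σx·D₁·x)(β−1) + (u₁−u₀)·D₁N(x)·(β−1)`
    have hS : D₁ 0 * ((u 0 : Kˣ) : K) * (α - 1) + D₁ 1 * ((u 1 : Kˣ) : K) * σ x * ((β - 1) * x) =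
        -(D₁ 0 * ((u 0 : Kˣ) : K) * (β - α)) +
          (((u 0 : Kˣ) : K) * (D₁ 0 + σ x * D₁ 1 * x) * (β - 1) + (((u 1 : Kˣ) : K) - (u 0 : Kˣ)) * (D₁ 1 * (σ x * x)) * (β - 1)) := by ring
    have hmain : Valued.v (-(D₁ 0 * ((u 0 : Kˣ) : K) * (β - α))) = Valued.v (ϖ ^ (d % 2)) := by
      rw [Valuation.map_neg, map_mul, map_mul, hvD0, huv 0, mul_one, Valuation.map_sub_swap, hγ, v_varpi_pow hϖ, ← WithZero.exp_add, hq]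
      congr 1; push_cast; omega
    have he1 : Valued.v (((u 0 : Kˣ) : K) * (D₁ 0 + σ x * D₁ 1 * x) * (β - 1)) ≤ WithZero.exp (((2 * ρ : ℕ) : ℤ) - n₁) := by
      rw [map_mul, map_mul, huv 0, one_mul, hβ, v_varpi_pow hϖ, sub_eq_add_neg, WithZero.exp_add]
      gcongr
    have he2 : Valued.v ((((u 1 : Kˣ) : K) - (u 0 : Kˣ)) * (D₁ 1 * (σ x * x)) * (β - 1)) ≤ WithZero.exp ((ρ : ℤ) - n₁) := by
      rw [map_mul, map_mul, map_mul, hvD1, hNx, mul_one, hβ, v_varpi_pow hϖ]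
      calc Valued.v (((u 1 : Kˣ) : K) - (u 0 : Kˣ)) * WithZero.exp ((2 * ρ + s : ℕ) : ℤ) * WithZero.exp (-(n₁ : ℤ))
          ≤ Valued.v (ϖ ^ (ρ + s)) * WithZero.exp ((2 * ρ + s : ℕ) : ℤ) * WithZero.exp (-(n₁ : ℤ)) := by gcongr
        _ = WithZero.exp ((ρ : ℤ) - n₁) := by rw [hq, ← WithZero.exp_add, ← WithZero.exp_add]; congr 1; push_cast; ring
    have herr : Valued.v (((u 0 : Kˣ) : K) * (D₁ 0 + σ x * D₁ 1 * x) * (β - 1) + (((u 1 : Kˣ) : K) - (u 0 : Kˣ)) * (D₁ 1 * (σ x * x)) * (β - 1)) <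
        Valued.v (ϖ ^ (d % 2)) := by
      refine (Valuation.map_add _ _ _).trans_lt (max_lt (he1.trans_lt ?_) (he2.trans_lt ?_))
      · rw [hq, WithZero.exp_lt_exp]; push_cast; omega
      · rw [hq, WithZero.exp_lt_exp]; push_cast; omega
    have hA : Valued.v (D₁ 0 * ((u 0 : Kˣ) : K) * (α - 1) + D₁ 1 * ((u 1 : Kˣ) : K) * σ x * ((β - 1) * x)) = Valued.v (ϖ ^ (d % 2)) := by
      rw [hS, Valuation.map_add_eq_of_lt_left _ (by rw [hmain]; exact herr), hmain]
    -- the congruence `A(u) ≡ G·t₊ (mod ϖ^{m*})` with `G = u₀·(−D₀e_C)·π₀^j`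
    have hπinv : (ϖ * σ ϖ) ^ j * ((ϖ * σ ϖ) ^ j)⁻¹ = (1 : K) := mul_inv_cancel₀ hπ0
    have hkey : (ϖ ^ (d % 2 + 2 * d - 1))⁻¹ * ((D₁ 0 * ((u 0 : Kˣ) : K) * (α - 1) + D₁ 1 * ((u 1 : Kˣ) : K) * σ x * ((β - 1) * x)) -
        ((u 0 : Kˣ) : K) * (-(D₁ 0 * eC)) * (ϖ * σ ϖ) ^ j * ((ϖ - σ ϖ) * ((ϖ * σ ϖ) ^ ((d - d % 2) / 2))⁻¹)) =
        -(D₁ 0 * (ϖ * σ ϖ) ^ j * ((u 0 : Kˣ) : K)) *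
            ((ϖ ^ (d % 2 + 2 * d - 1))⁻¹ * ((β - α) * ((ϖ * σ ϖ) ^ j)⁻¹ - eC * ((ϖ - σ ϖ) * ((ϖ * σ ϖ) ^ ((d - d % 2) / 2))⁻¹))) +
          ((ϖ ^ (d % 2 + 2 * d - 1))⁻¹ * (((u 0 : Kˣ) : K) * (D₁ 0 + σ x * D₁ 1 * x) * (β - 1)) +
            (ϖ ^ (d % 2 + 2 * d - 1))⁻¹ * ((((u 1 : Kˣ) : K) - (u 0 : Kˣ)) * (D₁ 1 * (σ x * x)) * (β - 1))) := by
      linear_combination (D₁ 0 * ((u 0 : Kˣ) : K) * (ϖ ^ (d % 2 + 2 * d - 1))⁻¹ * (β - α)) * hπinv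
    have hG : Valued.v ((ϖ ^ (d % 2 + 2 * d - 1))⁻¹ * ((D₁ 0 * ((u 0 : Kˣ) : K) * (α - 1) + D₁ 1 * ((u 1 : Kˣ) : K) * σ x * ((β - 1) * x)) -
        ((u 0 : Kˣ) : K) * (-(D₁ 0 * eC)) * (ϖ * σ ϖ) ^ j * ((ϖ - σ ϖ) * ((ϖ * σ ϖ) ^ ((d - d % 2) / 2))⁻¹))) ≤ 1 := by
      rw [hkey]
      refine (Valuation.map_add _ _ _).trans (max_le ?_ ((Valuation.map_add _ _ _).trans (max_le ?_ ?_)))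
      · rw [map_mul, Valuation.map_neg, map_mul, hD0π, huv 0, one_mul, one_mul]
        exact heC
      · rw [map_mul, map_inv₀, hq]
        calc (WithZero.exp (-((d % 2 + 2 * d - 1 : ℕ) : ℤ)))⁻¹ * Valued.v (((u 0 : Kˣ) : K) * (D₁ 0 + σ x * D₁ 1 * x) * (β - 1))
            ≤ (WithZero.exp (-((d % 2 + 2 * d - 1 : ℕ) : ℤ)))⁻¹ * WithZero.exp (((2 * ρ : ℕ) : ℤ) - n₁) := by gcongr
          _ ≤ 1 := by rw [← WithZero.exp_neg, ← WithZero.exp_add, ← WithZero.exp_zero, WithZero.exp_le_exp]; push_cast; omega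
      · rw [map_mul, map_inv₀, hq]
        calc (WithZero.exp (-((d % 2 + 2 * d - 1 : ℕ) : ℤ)))⁻¹ * Valued.v ((((u 1 : Kˣ) : K) - (u 0 : Kˣ)) * (D₁ 1 * (σ x * x)) * (β - 1))
            ≤ (WithZero.exp (-((d % 2 + 2 * d - 1 : ℕ) : ℤ)))⁻¹ * WithZero.exp ((ρ : ℤ) - n₁) := by gcongr
          _ ≤ 1 := by rw [← WithZero.exp_neg, ← WithZero.exp_add, ← WithZero.exp_zero, WithZero.exp_le_exp]; omega
    have hσG : σ (((u 0 : Kˣ) : K) * (-(D₁ 0 * eC)) * (ϖ * σ ϖ) ^ j) = ((u 0 : Kˣ) : K) * (-(D₁ 0 * eC)) * (ϖ * σ ϖ) ^ j := by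
      rw [map_mul, map_mul, map_neg, map_mul, huσ 0, (hD₁ 0).1, hσeC, hπjσ]
    have hread := valueClassLabel_latt_hnf_iff_normSign hD hDuσ hDu0 (b := ρ + s) (c := 2 * ρ) hx.le hy.le hzle
      (by rw [← hform, ← hM₀]; exact hnorm) (by rw [← hform, ← hM₀]; exact hVu) hE (mc := mcOfRecord d)
      (by omega) (by omega) (by rw [hmcv]; omega) (by rw [hmcv]; omega)
      (by rw [← hform, ← hM₀]; exact hlev) (by rw [← hform, ← hM₀]; exact hnlev) (by rw [← hform, ← hM₀]; exact hsq) hT (by rw [← hform, ← hM₀]; exact hTM) hA hσG hG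
    rw [← hform, ← hM₀] at hread
    have hσnDe : σ (-(D₁ 0 * eC)) = -(D₁ 0 * eC) := by rw [map_neg, map_mul, (hD₁ 0).1, hσeC]
    have hnDe0 : -(D₁ 0 * eC) ≠ 0 := neg_ne_zero.2 (mul_ne_zero (hD₁ 0).2 heC0)
    rw [hread, show ((u 0 : Kˣ) : K) * (-(D₁ 0 * eC)) * (ϖ * σ ϖ) ^ j = (((u 0 : Kˣ) : K) * (-(D₁ 0 * eC))) * (ϖ ^ j * σ (ϖ ^ j)) by rw [map_pow, ← mul_pow],
      normSign_mul_norm σ _ (pow_ne_zero j hϖ0), normSign_mul_of_dichotomy σ hσc hc hdich (huσ 0) hσnDe (u 0).ne_zero hnDe0, mul_comm]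
  -- ε = ω(−D₀e_C) = ω(−1)·ω(D₀)·ω(e_C); the heads of ★ p860757
  have hε : (normSign σ (-(D₁ 0 * eC)) : ℤ) = 1 ∨ (normSign σ (-(D₁ 0 * eC)) : ℤ) = -1 := normSign_eq_one_or σ _
  have hεmul : (normSign σ (-(D₁ 0 * eC)) : ℤ) = normSign σ (-1 : K) * normSign σ (D₁ 0) * normSign σ eC := by
    rw [show -(D₁ 0 * eC) = (-1 : K) * (D₁ 0 * eC) by ring,
      normSign_mul_of_dichotomy σ hσc hc hdich (by rw [map_neg, map_one]) (by rw [map_mul, (hD₁ 0).1, hσeC]) (neg_ne_zero.2 one_ne_zero) (mul_ne_zero (hD₁ 0).2 heC0),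
      normSign_mul_of_dichotomy σ hσc hc hdich (hD₁ 0).1 hσeC (hD₁ 0).2 heC0, mul_assoc]
  have hD0sq : (normSign σ (D₁ 0) : ℚ) * (normSign σ (D₁ 0) : ℚ) = 1 := by exact_mod_cast normSign_mul_self σ (D₁ 0)
  by_cases hi0 : i = 0
  · subst hi0
    rw [labelledOddCount_div_relIndex_eq_of_oneSlot_same hσ hvσ hσc hcv hc hdich hfin hD₁ hV₁ hcoset _ 0 hε hΛ, hεmul]
    simp only [Matrix.cons_val_zero]; push_cast
    linear_combination ((normSign σ (-1 : K) : ℚ) * (normSign σ eC : ℚ) / 2 * stabiliserWeight σ M₀) * hD0sq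
  by_cases hi1 : i = 1
  · subst hi1
    rw [labelledOddCount_div_relIndex_eq_kappaCount_mul_of_oneSlot hσ hvσ hσc hcv hc hdich hfin hD₁ hV₁ hcoset _ (i := 1) (k := 0) (m := 2)
      (by decide) (by decide) (by decide) hε hΛ, hεmul]
    simp only [Matrix.cons_val_one, Matrix.cons_val_zero]; push_cast
    linear_combination ((normSign σ (-1 : K) : ℚ) * (normSign σ eC : ℚ) / 2 * (kappaCount σ ϖ 0 2 M₀ : ℚ) * stabiliserWeight σ M₀) * hD0sq
  · obtain rfl : i = 2 := by
      fin_cases i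
      · exact absurd rfl hi0
      · exact absurd rfl hi1
      · rfl
    rw [labelledOddCount_div_relIndex_eq_kappaCount_mul_of_oneSlot hσ hvσ hσc hcv hc hdich hfin hD₁ hV₁ hcoset _ (i := 2) (k := 0) (m := 1)
      (by decide) (by decide) (by decide) hε hΛ, hεmul]
    simp only [Matrix.cons_val_two, Matrix.tail_cons, Matrix.head_cons]; push_cast
    linear_combination ((normSign σ (-1 : K) : ℚ) * (normSign σ eC : ℚ) / 2 * (kappaCount σ ϖ 0 1 M₀ : ℚ) * stabiliserWeight σ M₀) * hD0sq

/-! ## §2  Membership form: the value on every member of the stratum `(2ρ+s, 2ρ+s, 2ρ)` on the read, in the cell -/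

/-- **THE READ ON A MEMBER OF THE STRATUM `G₃ = (2ρ+s, 2ρ+s, 2ρ)`** (the `hval` letter of the (P2b) sum file): for `M ∈ stratum σ ϖ T (2ρ+s, 2ρ+s, 2ρ)` (`ρ, s ≥ 1`) on the
clean shell, in the cell `2ρ + m* ≤ n₁` and on the read `2ρ + s + ℓ₀ = n₃`, with `e_C` the tower-sign token of `β − α` at exponent `(n₃ − ℓ₀)∕2`:
`labelledOddCount σ ϖ 0 i Λ M ∕ [𝒰 : N(S̃′(M))] = ω(−1)·ω(e_C) ∕ 2 · (1, κ₂(M), κ₁(M))_i · stabiliserWeight σ M` (§1 on the G₃ normal form of ★ `stratum_G3_eq`; `s` is even by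
★ `two_dvd_of_mem_stratum_G3`; the orbit is finite by ★ `finite_unitTorus_orbit_of_mem_normalisedStableLattices`). [cite: Kottwitz1986BaseChangeUnits, §1 pp. 240–241]
[cite: Rogawski1990, §4.9 Prop. 4.9.1 (a)(b) p. 55, §4.10 p. 58] [cite: LanglandsShelstad1987, §3] [cite: Serre1979, Ch. V §3 Cor. 3] -/
theorem labelledOddCount_div_relIndex_of_mem_stratum_G3 (hD : IsRamifiedQuadraticDatum σ ϖ d t) (h2d : 2 ≤ d)
    (hE : IsElementDatum σ ϖ N₀ α β n₁ n₂ n₃) (hmc : mcOfRecord d ≤ N₀)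
    (T : GL (Fin 3) K) (hT : (T : Matrix (Fin 3) (Fin 3) K) = Matrix.diagonal ![α, β, 1])
    {ρ s : ℕ} (hρ : 1 ≤ ρ) (hs : 1 ≤ s) (hcell : 2 * ρ + mstarOfRecord d ≤ n₁) (hP : 2 * ρ + s + d % 2 = n₃)
    {M : Submodule 𝒪[K] (Fin 3 → K)} (hM : M ∈ stratum σ ϖ T ![2 * ρ + s, 2 * ρ + s, 2 * ρ])
    (hlev : LatticeInLevel ϖ (d % 2) (Matrix.diagonal ![α - 1, β - 1, 0]) M) (hnlev : ¬ LatticeInLevel ϖ (d % 2 + 1) (Matrix.diagonal ![α - 1, β - 1, 0]) M)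
    (hsq : LatticeInLevel ϖ (mcOfRecord d) (Matrix.diagonal ![(α - 1) * (α - 1), (β - 1) * (β - 1), 0]) M)
    {eC : K} (hσeC : σ eC = eC) (heC1 : Valued.v eC = 1)
    (heC : Valued.v ((ϖ ^ mstarOfRecord d)⁻¹ * ((β - α) * ((ϖ * σ ϖ) ^ ((n₃ - d % 2) / 2))⁻¹ - eC * ((ϖ - σ ϖ) * ((ϖ * σ ϖ) ^ ((d - d % 2) / 2))⁻¹))) ≤ 1)
    (i : Fin 3) :
    (labelledOddCount σ ϖ 0 i (valueClassLabel σ ϖ (α - 1) (β - 1) (mstarOfRecord d) d) M : ℚ) /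
        ((((unitStabilizer M).map (unitNormMap σ 3)).relIndex (fixedUnitTorus σ 3) : ℕ) : ℚ) =
      (normSign σ (-1 : K) : ℚ) * (normSign σ eC : ℚ) / 2 *
        ((((![1, kappaCount σ ϖ 0 2 M, kappaCount σ ϖ 0 1 M] : Fin 3 → ℤ) i) : ℤ) : ℚ) * stabiliserWeight σ M := by
  have hD' := hD
  obtain ⟨hσ, hvσ, hϖ, hfix, -, -, -⟩ := hD'
  have hmsv : mstarOfRecord d = d % 2 + 2 * d - 1 := rfl
  rw [hmsv] at hcell heC ⊢
  obtain ⟨j', hj'⟩ := two_dvd_of_mem_stratum_G3 hvσ hfix hϖ T hρ hs hM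
  have hjn : (n₃ - d % 2) / 2 = ρ + j' := by omega
  rw [hjn] at heC
  have hM' := hM
  rw [stratum_G3_eq hvσ hfix hϖ T hρ hs] at hM'
  obtain ⟨x, y, z, hx, hy, hz, hMe, hTM, hdual⟩ := hM'
  exact labelledOddCount_div_relIndex_latt_G3 hD h2d hE hmc T hT hρ hs hx hy hz (ρ + j') (by omega) (by omega) hcell hMe hTM hdual hlev hnlev hsq
    (finite_unitTorus_orbit_of_mem_normalisedStableLattices hϖ (v_diag_eq_one hvσ hE) (diag_regular hE) T hT hM.1) hσeC heC1 heC i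

end Summit.HodgeConjecture.HodgeConjecture.Cruxes.H413.F0P3cDyRamLabelledOddPureLatticeG3

end
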